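import Summits.BirchSwinnertonDyer.BirchSwinnertonDyer.Theses.PrintCf2RubinValueTwo
import Summits.BirchSwinnertonDyer.BirchSwinnertonDyer.Theorems.PrintCf2DisegniPairTwoTwistScaling
import Summits.BirchSwinnertonDyer.BirchSwinnertonDyer.Theorems.PrintCf2DisegniPairTwoDisegniGZPairEight
import Literature.NumberTheory.EllipticCurves.PadicSigmaSqMinusTwist
import Literature.NumberTheory.EllipticCurves.BertrandCMHeightNonvanishingMinusTwist
import Literature.NumberTheory.EllipticCurves.Disegni2020.PAdicBSDRankOneMultiplicativeProofs
import HarnessLib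

/-!
# Line `rubin_ratio_v13` for the crux `PrintCf2RubinValueTwo.RubinValueFormulaAtTwoV13` (stmt-BirchSwinnertonDyer-31080)

RUBIN'S ROAD in valuation currency, with Rubin's cyclotomic derivative `L₂′(ν_W)` REALISED on the `χ_{d*}`-branch of
the Mazur–Tate–Teitelbaum `2`-adic `L`-function of the GOOD ORDINARY twin `V = 49a1^{(d′)}` (`d = d*·d′`, `d′ ≡ 1 (4)`,
`d* ∈ {2, −1, −2}`), and Perrin-Riou's `p`-adic Gross–Zagier replaced by the tree's Disegni pair key.

Rubin 1992 (Cor. 10.3) / BDP 2012 (eqs. (2)–(5)): the elliptic-unit class `κ_W ∈ Sel₂(W/ℚ)` has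
`log κ_W ∝ L₂(ν_W*)·Ω₂` (explicit reciprocity) and `⟨κ_W, κ_W⟩ ∝ L₂′(ν_W)·L₂(ν_W*)` (Rubin Thm 8.1); in rank one
with `Ш(W)` finite `Sel₂ ⊗ ℚ₂` is the line of the generator `P`, whence the RATIO LAW (BDP (4))
`log²(P)/⟨P,P⟩₂ ∝ L₂(ν_W*)·Ω₂²/L₂′(ν_W)` — a purely `2`-adic identity between the Katz value at the OUT-OF-RANGE point
`(ψ_W^c)⁻¹` (our `val`, read on the `θ`-branch `G₂` pinned by the frame `IsKatzMeasure₂₀` and the MC clause), the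
cyclotomic derivative at the IN-RANGE point `ν_W` (our `D`, := the derivative at the `χ_{d*}`-point of `L₂(f_V, α)`, the
`2`-adic `L`-function of the newform of the ordinary twin — the only bounded `2`-adic measure seeing `L(W ⊗ χ_s, 1)`), the
canonical `2`-adic height `⟨P*, P*⟩` (minus-twist receptacle `IsCanonicalSqMinusTwist`) and the formal logarithm `ℓ`.
Perrin-Riou's step (5) `⟨P,P⟩₂ ↔ L₂′(ν_W)·(L′(W,1)/(Ω ĥ(P)))` is, in this currency, the DISEGNI PAIR KEY of the tree
(`DisegniPairTwo.defectKey_chi8/chi4/chi8'_modulo_descent_min`, fed by the eight-prints ticket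
`disegniGZ_pair_two_of_eight_prints`: Disegni 2017 Thm B at the base-change character + YZZ + Bertrand + the pin).

STUBS (3): `stub_rubinRatio_two` [RESEARCH, L — the whole research content of V13 minus its complex-analytic part: a
`2`-adic reciprocity law with NO complex `L`-value in it], `stub_disegniKey_shaAn_two` [PRINT-CONJOINED, M: the tree's
★★★ keys modulo the named prints; `7 ∣ d` by the `7`-isogeny over `K`], `stub_pairFrame_two` [ASSEMBLY, S–M: the
presentation `W ≅ V^{(d*)}`, newform, period ratio, generator, canonical minus-twist datum — `DisegniPairTwoV3.stub_frame_two`'s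
`ℚ`-side plus the receptacle's pinning theorem]. COMPOSITION `RubinValueFormulaAtTwoV13_of`: `q` from
`Disegni2020.exists_rat_shaAn_eq_of_analyticRank_eq_one`, the class arithmetic by `omega`; `eA := 2·e₂ + e₁`.
HONEST: nothing here proves the crux; the skeleton is line supply (linewriter-bsd-rubinvaluetwo-1 g0).

[cite: Rubin1992, Cor. 10.3, Thm. 8.1] [cite: BertoliniDarmonPrasanna2012Pacific, Thm. 1 and eqs. (2)–(5) (pp. 2–3)]
[cite: Disegni2017, Thm B] [cite: PerrinRiou1987, Thm 1.3] [cite: MazurTateTeitelbaum1986Invent, §I.14]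
[cite: Bertrand1984ThetaCM, §3 Cor. 1] [cite: deShalit1987, II Thm. 4.14] [cite: Agboola2007, Thm. 2]
-/

set_option autoImplicit false
set_option linter.dupNamespace false

noncomputable section

open scoped Classical MatrixGroups ModularForm NumberField

open CongruenceSubgroup NumberField IsDedekindDomain Field WeierstrassCurve
  Literature.NumberTheory Literature.NumberTheory.EllipticCurves Literature.NumberTheory.EllipticCurves.ModularForms
  Literature.NumberTheory.EllipticCurves.Disegni2017 Literature.NumberTheory.GaloisRepresentations
  Literature.NumberTheory.EllipticCurves.Rank1Residual Literature.NumberTheory.EllipticCurves.DeShalit1987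
  Summit.BirchSwinnertonDyer.BirchSwinnertonDyer.Theses.PrintCf2
  Summit.BirchSwinnertonDyer.BirchSwinnertonDyer.Theorems

namespace Summit.BirchSwinnertonDyer.BirchSwinnertonDyer.Cruxes.RubinValueFormulaAtTwoV13.RubinRatioV13

/-- **stub_rubinRatio_two** [RESEARCH, L — Rubin's ratio law at the split prime `2` for the additive CM member,
MTT currency]. For every member `W = 49a1^{(d)}` of the class (the binders of `RubinValueFormulaAtTwoV13` VERBATIM: frame
`IsKatzMeasure₂₀` on the `θ`-branch, MC clause pinning `G₂`, generator `P ∈ W(ℚ)` with `‖log(c₀P)/c₀‖ = 2^{−ℓ}`), and every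
presentation `CV • W = V.quadraticTwist d*` by the good ordinary twin `V` with newform `f`, period ratio `ϖ`/`μ`, generator
`P* ∈ V^{(d*)}(ℚ)` and canonical minus-twist datum `Dc`: the value `val = G₂((ψ^c)⁻¹-point)` satisfies
`2·v₂(val) = m = 2·(v₂ D + v₂ ϖ − v₂⟨P*,P*⟩) + 4ℓ + e₁(class)`, `D` the derivative of `L₂(f_V, α_V)` at the `χ_{d*}`-point
(`χ₈`: `Σ k[T^k]L₂·(−2)^{k−1}`; `χ₋₄`: `[T¹]L₂⁻`; `χ₋₈`: `Σ k[T^k]L₂⁻·(−2)^{k−1}`). = BDP 2012 eq. (4) (Rubin 1992 Thm 8.1 +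
Wiles/de Shalit explicit reciprocity for `κ_W = t·P`) with `L₂′(ν_W)` read on the MTT branch (Katz restricted to the cyclotomic
line through `ν_W` = the `χ_{d*}`-branch of `L₂(f_V)`: both interpolate `L(W ⊗ χ_s, 1)`). WHY IT MIGHT FAIL: no explicit
reciprocity / Rubin Thm 8.1 in print at `p = 2 ∣ 𝔣` (`2 ∣ #𝒪_K^×`); the Katz-vs-MTT branch comparison for the non-ordinary form
`f_W = f_V ⊗ χ_{d*}` must be made through `f_V`; the class-uniformity of the Euler-type and period factors is part of the claim.
[cite: Rubin1992, Thm. 8.1, Cor. 10.3] [cite: BertoliniDarmonPrasanna2012Pacific, eqs. (2)–(4)] [cite: deShalit1987, I Thm. 4.2 (explicit reciprocity), II Thm. 4.14]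
[cite: MazurTateTeitelbaum1986Invent, §I.14] -/
theorem stub_rubinRatio_two :
    ∃ e₁ : ℤ → ℤ → ℤ,
    ∀ (d : ℤ), d ≠ 0 → Squarefree d → d % 4 ≠ 1 → ∀ (W : WeierstrassCurve ℚ) [W.IsElliptic] [W.IsGloballyMinimal] (C : VariableChange ℚ), C • W = cm7.quadraticTwist (d : ℚ) → W.analyticRank = 1 → Finite W.sha → ∀ (K : Type) [Field K] [NumberField K], IsImaginaryQuadratic K → ¬ 2 ∣ NumberField.classNumber K → NumberField.discr K = -7 → ∀ (v vbar : HeightOneSpectrum (𝓞 K)), ((2 : ℕ) : 𝓞 K) ∈ v.asIdeal → ((2 : ℕ) : 𝓞 K) ∈ vbar.asIdeal → vbar ≠ v → ∀ (ι : PadicAlgCl 2 ≃+* ℂ), (∀ (w : InfinitePlace K) (k : 𝓞 K), k ∈ v.asIdeal ↔ ‖ι.symm (w.embedding (k : K))‖ < 1) → ∀ (c : K ≃ₐ[ℚ] K), c ≠ 1 → ∀ (ψ : HeckeCharacter K), ψ.HasInfinityType (fun _ ↦ 1) (fun _ ↦ 0) → (∀ s : ℂ, 3 / 2 < s.re → heckeLFunction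 ψ s = W.LSeries s) → ∀ (κ₁ κ₂ : ZpExtension K 2) (γ₁ γ₂ : absoluteGaloisGroup K), ZpExtension.IsTopGeneratorPair κ₁ κ₂ γ₁ γ₂ → κ₂.IsUnramifiedOutside vbar → κ₁.IsUnramifiedOutside v → γ₁ ∈ GreenbergSelmer.inertia v → γ₂ ∈ GreenbergSelmer.inertia vbar → ∀ (θ : FramedGaloisRep K (padicCoeffIntegers (∅ : Set (PadicAlgCl 2))) 1) (θK ρ : HeckeCharacter K) (r : FramedGaloisRep K (PadicAlgCl 2) 1), (∀ σ : absoluteGaloisGroup K, θ σ ^ 2 = 1) → KellerYin2024.IsHeckeCharOf ι θ θK → θK * θK = 1 → IsPAdicAvatarOf ι ρ r → FactorsThroughPair κ₁ κ₂ r → θK⁻¹ * ρ = (HeckeCharacter.galConj c ψ)⁻¹ → ∀ (Sθ : Finset (HeightOneSpectrum (𝓞 K))), v ∉ Sθ → vbar ∉ Sθ → (∀ w ∈ Sθ, ¬ θK.IsUnramifiedAt w) → (∀ w : HeightOneSpectrum (𝓞 K), w ∉ Sθ → w ≠ v → w ≠ vbar → θK.IsUnramifiedAt w) → (∃ σ ∈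 ZpExtension.pairKer κ₁ κ₂, θ σ ≠ 1) → (∃ (W' : WeierstrassCurve ℚ) (_ : W'.IsElliptic) (_ : W'.IsGloballyMinimal) (ψ' ρ' : HeckeCharacter K) (r' r'' : FramedGaloisRep K (PadicAlgCl 2) 1), W'.j ∈ maximalCMJInvariants ∧ IsCMFieldOfJ K W'.j ∧ CMSplit W' 2 ∧ W'.HasGoodReductionAtPrime 2 ∧ ¬ (2 : ℤ) ∣ W'.frobeniusTrace 2 ∧ (ψ'.HasInfinityType (fun _ ↦ 1) (fun _ ↦ 0) ∨ ψ'.HasInfinityType (fun _ ↦ 0) (fun _ ↦ 1)) ∧ (∀ s : ℂ, 3 / 2 < s.re → heckeLFunction ψ' s = W'.LSeries s) ∧ IsPAdicAvatarOf ι ψ' r' ∧ (∃ χ' : absoluteGaloisGroup K →ₜ* ℤ_[2]ˣ, ∀ σ : absoluteGaloisGroup K, ((((χ' σ : ℤ_[2]ˣ) : ℤ_[2]) : ℚ_[2]) : ℂ_[2]) = avatarValueAt r' σ) ∧ (∀ w : HeightOneSpectrum (𝓞 K), w ∈ Sθ ↔ ¬ ψ'.IsUnramifiedAt w) ∧ (∀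 υ : absoluteGaloisGroup K, υ ∈ ZpExtension.pairKer κ₁ κ₂ → ((((KellerYin2024.unitChar θ υ : ℤ_[2]ˣ) : ℤ_[2]) : ℚ_[2]) : ℂ_[2]) = avatarValueAt r' υ) ∧ ψ'⁻¹ * ρ' = θK⁻¹ ∧ IsPAdicAvatarOf ι ρ' r'' ∧ FactorsThroughPair κ₁ κ₂ r'' ∧ (∀ w : HeightOneSpectrum (𝓞 K), ((2 : ℕ) : 𝓞 K) ∉ w.asIdeal → ρ'.IsUnramifiedAt w) ∧ (∀ σ : absoluteGaloisGroup K, avatarValueAt r'' σ = avatarValueAt r' σ * ((((KellerYin2024.unitChar θ σ : ℤ_[2]ˣ) : ℤ_[2]) : ℚ_[2]) : ℂ_[2]))) → ∀ (Ω δ : ℂ) (Ωp : (unrIntegers 2)ˣ) (G₂ : PowerSeries (PowerSeries (PadicComplexInt 2))), Ω ≠ 0 → (δ ^ 2 = (NumberField.discr K : ℂ) ∨ δ ^ 2 = -(NumberField.discr K : ℂ)) → IsKatzMeasure₂₀ ι v vbar Sθ κ₁ κ₂ γ₁⁻¹ γ₂⁻¹ θK⁻¹ Ω δ ((Ωp :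 unrIntegers 2) : ℂ_[2]) G₂ → (∀ D₂ : DualData₂ κ₁ κ₂ (KellerYin2024.charModule (∅ : Set (PadicAlgCl 2)) θ) vbar γ₁ γ₂, Module.Finite (IwasawaAlgebra₂ 2) D₂.X ∧ Module.IsTorsion (IwasawaAlgebra₂ 2) D₂.X ∧ ∀ (J : ℤ_[2] →+* PadicComplexInt 2), (∀ x : ℤ_[2], ((J x : PadicComplexInt 2) : ℂ_[2]) = ((x : ℚ_[2]) : ℂ_[2])) → (Module.charIdeal (IwasawaAlgebra₂ 2) D₂.X).map (PowerSeries.map (PowerSeries.map J)) = Ideal.span {G₂}) → ∀ (P : W.toAffine.Point) (c₀ : ℕ) (ℓ : ℤ), ¬ IsOfFinAddOrder P → (∀ R : W.toAffine.Point, ∃ (k : ℤ) (T : W.toAffine.Point), IsOfFinAddOrder T ∧ R = k • P + T) → c₀ ≠ 0 → (W.baseChange ℚ_[2]).IsInReductionKernel (c₀ • W.toPadicPoint 2 P) → ‖(W.baseChange ℚ_[2]).padicLogPoint (c₀ • W.toPadicPoint 2 P) / (c₀ : ℚ_[2])‖ = (2 : ℝ) ^ (-ℓ) →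
    (∀ (d' : ℤ), d = 2 * d' → d' % 4 = 1 → Squarefree d' →
      ∀ (V : WeierstrassCurve ℚ) [V.IsElliptic] [V.IsGloballyMinimal] (C₁ : VariableChange ℚ),
        C₁ • V = cm7.quadraticTwist (d' : ℚ) →
      ∀ {N : ℕ} [NeZero N] (f : CuspForm (Gamma0 N) 2), IsNewformOf V f →
      ∀ (ϖ : ℚ), ϖ ≠ 0 → (ϖ : ℝ) * V.realPeriodRat = plusPeriod f →
      ∀ [(V.quadraticTwist 2).IsElliptic] (CV : VariableChange ℚ), CV • W = V.quadraticTwist 2 →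
      ∀ (Pstar : (V.quadraticTwist 2).toAffine.Point), ¬ IsOfFinAddOrder Pstar →
        (∀ R : (V.quadraticTwist 2).toAffine.Point,
          ∃ (k : ℤ) (T : (V.quadraticTwist 2).toAffine.Point), IsOfFinAddOrder T ∧ R = k • Pstar + T) →
      ∀ (Dc : PAdicHeightData (V.quadraticTwist 2) 2), Dc.IsCanonicalSqMinusTwist →
      ∀ (val : ℂ_[2]) (m : ℤ), IntSeries.HasValueAt₂ G₂ (avatarValueAt r γ₁⁻¹ - 1) (avatarValueAt r γ₂⁻¹ - 1) val → ‖val‖ = (2 : ℝ) ^ (-(m : ℝ) / 2) →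
        m = 2 * ((∑' k : ℕ, PowerSeries.coeff k (padicLFunction f (unitRoot V 2 : ℚ_[2])) * (k : ℚ_[2]) * (-2) ^ (k - 1)).valuation + padicValRat 2 ϖ - (Dc.pairing Pstar Pstar).valuation) + 4 * ℓ + e₁ 0 (d' % 8)) ∧
    (∀ (d' : ℤ), d = -d' → d' % 4 = 1 → Squarefree d' →
      ∀ (V : WeierstrassCurve ℚ) [V.IsElliptic] [V.IsGloballyMinimal] (C₁ : VariableChange ℚ),
        C₁ • V = cm7.quadraticTwist (d' : ℚ) →
      ∀ {N : ℕ} [NeZero N] (f : CuspForm (Gamma0 N) 2), IsNewformOf V f →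
      ∀ (μ : ℚ), μ ≠ 0 → (μ : ℝ) * V.imaginaryPeriodRat = minusPeriod f →
      ∀ [(V.quadraticTwist (-1)).IsElliptic] (CV : VariableChange ℚ), CV • W = V.quadraticTwist (-1) →
      ∀ (Pstar : (V.quadraticTwist (-1)).toAffine.Point), ¬ IsOfFinAddOrder Pstar →
        (∀ R : (V.quadraticTwist (-1)).toAffine.Point,
          ∃ (k : ℤ) (T : (V.quadraticTwist (-1)).toAffine.Point), IsOfFinAddOrder T ∧ R = k • Pstar + T) →
      ∀ (Dc : PAdicHeightData (V.quadraticTwist (-1)) 2), Dc.IsCanonicalSqMinusTwist →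
      ∀ (val : ℂ_[2]) (m : ℤ), IntSeries.HasValueAt₂ G₂ (avatarValueAt r γ₁⁻¹ - 1) (avatarValueAt r γ₂⁻¹ - 1) val → ‖val‖ = (2 : ℝ) ^ (-(m : ℝ) / 2) →
        m = 2 * ((PowerSeries.coeff 1 (padicLFunctionMinusBranch f (unitRoot V 2 : ℚ_[2]) 1)).valuation + padicValRat 2 μ - (Dc.pairing Pstar Pstar).valuation) + 4 * ℓ + e₁ 1 ((-d') % 8)) ∧
    (∀ (d' : ℤ), d = -2 * d' → d' % 4 = 1 → Squarefree d' →
      ∀ (V : WeierstrassCurve ℚ) [V.IsElliptic] [V.IsGloballyMinimal] (C₁ : VariableChange ℚ),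
        C₁ • V = cm7.quadraticTwist (d' : ℚ) →
      ∀ {N : ℕ} [NeZero N] (f : CuspForm (Gamma0 N) 2), IsNewformOf V f →
      ∀ (μ : ℚ), μ ≠ 0 → (μ : ℝ) * V.imaginaryPeriodRat = minusPeriod f →
      ∀ [(V.quadraticTwist (-2)).IsElliptic] (CV : VariableChange ℚ), CV • W = V.quadraticTwist (-2) →
      ∀ (Pstar : (V.quadraticTwist (-2)).toAffine.Point), ¬ IsOfFinAddOrder Pstar →
        (∀ R : (V.quadraticTwist (-2)).toAffine.Point,
          ∃ (k : ℤ) (T : (V.quadraticTwist (-2)).toAffine.Point), IsOfFinAddOrder T ∧ R = k • Pstar + T) →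
      ∀ (Dc : PAdicHeightData (V.quadraticTwist (-2)) 2), Dc.IsCanonicalSqMinusTwist →
      ∀ (val : ℂ_[2]) (m : ℤ), IntSeries.HasValueAt₂ G₂ (avatarValueAt r γ₁⁻¹ - 1) (avatarValueAt r γ₂⁻¹ - 1) val → ‖val‖ = (2 : ℝ) ^ (-(m : ℝ) / 2) →
        m = 2 * ((∑' k : ℕ, PowerSeries.coeff k (padicLFunctionMinusBranch f (unitRoot V 2 : ℚ_[2]) 1) * (k : ℚ_[2]) * (-2) ^ (k - 1)).valuation + padicValRat 2 μ - (Dc.pairing Pstar Pstar).valuation) + 4 * ℓ + e₁ 0 ((-d') % 8)) := by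
  sorry

/-- **stub_disegniKey_shaAn_two** [PRINT-CONJOINED, M — the Disegni pair key in `Dc`/`shaAn` currency]. For every
presentation of a rank-one member, `v₂ D + v₂ ϖ − v₂⟨P*,P*⟩ = v₂ q + v₂ Tam(W) − 2 v₂ #W(ℚ)_tors + e₂(class)` where
`shaAn W = q`: Disegni 2017 Thm B at the base-change character `χ_{d*}∘N_K` (YZZ for the archimedean side) for the good twin's
newform, the PIN of Disegni's `H`-datum to the receptacle (`DisegniPairTwo.pairing_eq_minusTwist_pairing_of_pair`), Bertrand
(`bertrand_pairingSqMinusTwist_self_ne_zero_two`) — for `7 ∤ d` this is the tree's ★★★ `DisegniPairTwo.defectKey_chi8_modulo_descent_min`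
/ `defectKey_chi4_modulo_descent_min(_of_Δ_neg)` / `defectKey_chi8'_modulo_descent_min(_of_Δ_neg)` fed by the eight-prints
ticket `disegniGZ_pair_two_of_eight_prints` and the frame theorems of `DisegniPairTwoV3` (v3.10); for `7 ∣ d` transport along
the `7`-isogeny `49a1^{(d)} ~ 49a1^{(−d/7)}` (same Grössencharacter over `K`). WHY IT MIGHT FAIL: only as typing — the offset
must absorb `[H:ℚ(√d*)]`, the receptacle's `½`, `c_∞(V)` and the Manin/lattice index; closes by Literature admission of the prints.
[cite: Disegni2017, Thm B (arXiv v3 p. 8), (1.1.3)] [cite: YuanZhangZhang2013, Thm. 1.2] [cite: Bertrand1984ThetaCM, §3 Cor. 1]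
[cite: GrossZagier1986, Thm. I.(7.3)] [cite: MazurSteinTate2006, §1] -/
theorem stub_disegniKey_shaAn_two :
    GrossZagier1986_thm_I_7_3 → rank_eq_analyticRank_of_analyticRank_le_one →
    ∃ e₂ : ℤ → ℤ → ℤ,
    (∀ (d' : ℤ), d' % 4 = 1 → Squarefree d' →
      ∀ (V : WeierstrassCurve ℚ) [V.IsElliptic] [V.IsGloballyMinimal] (C₁ : VariableChange ℚ),
        C₁ • V = cm7.quadraticTwist (d' : ℚ) →
      ∀ {N : ℕ} [NeZero N] (f : CuspForm (Gamma0 N) 2), IsNewformOf V f →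
      ∀ (ϖ : ℚ), ϖ ≠ 0 → (ϖ : ℝ) * V.realPeriodRat = plusPeriod f →
      ∀ (W : WeierstrassCurve ℚ) [W.IsElliptic] [W.IsGloballyMinimal] [(V.quadraticTwist 2).IsElliptic]
        (CV : VariableChange ℚ), CV • W = V.quadraticTwist 2 → W.analyticRank = 1 →
      ∀ (q : ℚ), shaAn W = (q : ℂ) →
      ∀ (Pstar : (V.quadraticTwist 2).toAffine.Point), ¬ IsOfFinAddOrder Pstar →
        (∀ R : (V.quadraticTwist 2).toAffine.Point,
          ∃ (k : ℤ) (T : (V.quadraticTwist 2).toAffine.Point), IsOfFinAddOrder T ∧ R = k • Pstar + T) →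
      ∀ (Dc : PAdicHeightData (V.quadraticTwist 2) 2), Dc.IsCanonicalSqMinusTwist →
        (∑' k : ℕ, PowerSeries.coeff k (padicLFunction f (unitRoot V 2 : ℚ_[2])) * (k : ℚ_[2]) * (-2) ^ (k - 1)).valuation + padicValRat 2 ϖ - (Dc.pairing Pstar Pstar).valuation =
          padicValRat 2 q + (padicValNat 2 W.tamagawaProduct : ℤ) - 2 * (padicValNat 2 W.torsionOrder : ℤ) + e₂ 0 (d' % 8)) ∧
    (∀ (d' : ℤ), d' % 4 = 1 → Squarefree d' →
      ∀ (V : WeierstrassCurve ℚ) [V.IsElliptic] [V.IsGloballyMinimal] (C₁ : VariableChange ℚ),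
        C₁ • V = cm7.quadraticTwist (d' : ℚ) →
      ∀ {N : ℕ} [NeZero N] (f : CuspForm (Gamma0 N) 2), IsNewformOf V f →
      ∀ (μ : ℚ), μ ≠ 0 → (μ : ℝ) * V.imaginaryPeriodRat = minusPeriod f →
      ∀ (W : WeierstrassCurve ℚ) [W.IsElliptic] [W.IsGloballyMinimal] [(V.quadraticTwist (-1)).IsElliptic]
        (CV : VariableChange ℚ), CV • W = V.quadraticTwist (-1) → W.analyticRank = 1 →
      ∀ (q : ℚ), shaAn W = (q : ℂ) →
      ∀ (Pstar : (V.quadraticTwist (-1)).toAffine.Point), ¬ IsOfFinAddOrder Pstar →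
        (∀ R : (V.quadraticTwist (-1)).toAffine.Point,
          ∃ (k : ℤ) (T : (V.quadraticTwist (-1)).toAffine.Point), IsOfFinAddOrder T ∧ R = k • Pstar + T) →
      ∀ (Dc : PAdicHeightData (V.quadraticTwist (-1)) 2), Dc.IsCanonicalSqMinusTwist →
        (PowerSeries.coeff 1 (padicLFunctionMinusBranch f (unitRoot V 2 : ℚ_[2]) 1)).valuation + padicValRat 2 μ - (Dc.pairing Pstar Pstar).valuation =
          padicValRat 2 q + (padicValNat 2 W.tamagawaProduct : ℤ) - 2 * (padicValNat 2 W.torsionOrder : ℤ) + e₂ 1 ((-d') % 8)) ∧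
    (∀ (d' : ℤ), d' % 4 = 1 → Squarefree d' →
      ∀ (V : WeierstrassCurve ℚ) [V.IsElliptic] [V.IsGloballyMinimal] (C₁ : VariableChange ℚ),
        C₁ • V = cm7.quadraticTwist (d' : ℚ) →
      ∀ {N : ℕ} [NeZero N] (f : CuspForm (Gamma0 N) 2), IsNewformOf V f →
      ∀ (μ : ℚ), μ ≠ 0 → (μ : ℝ) * V.imaginaryPeriodRat = minusPeriod f →
      ∀ (W : WeierstrassCurve ℚ) [W.IsElliptic] [W.IsGloballyMinimal] [(V.quadraticTwist (-2)).IsElliptic]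
        (CV : VariableChange ℚ), CV • W = V.quadraticTwist (-2) → W.analyticRank = 1 →
      ∀ (q : ℚ), shaAn W = (q : ℂ) →
      ∀ (Pstar : (V.quadraticTwist (-2)).toAffine.Point), ¬ IsOfFinAddOrder Pstar →
        (∀ R : (V.quadraticTwist (-2)).toAffine.Point,
          ∃ (k : ℤ) (T : (V.quadraticTwist (-2)).toAffine.Point), IsOfFinAddOrder T ∧ R = k • Pstar + T) →
      ∀ (Dc : PAdicHeightData (V.quadraticTwist (-2)) 2), Dc.IsCanonicalSqMinusTwist →
        (∑' k : ℕ, PowerSeries.coeff k (padicLFunctionMinusBranch f (unitRoot V 2 : ℚ_[2]) 1) * (k : ℚ_[2]) * (-2) ^ (k - 1)).valuation + padicValRat 2 μ - (Dc.pairing Pstar Pstar).valuation =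
          padicValRat 2 q + (padicValNat 2 W.tamagawaProduct : ℤ) - 2 * (padicValNat 2 W.torsionOrder : ℤ) + e₂ 0 ((-d') % 8)) := by
  sorry

/-- **stub_pairFrame_two** [ASSEMBLY, S–M — the presentation data exist]. Every member `C • W = cm7.quadraticTwist d`
(`d` squarefree, `d ≢ 1 (4)`, analytic rank one) is `CV • W = V.quadraticTwist d*` for the globally minimal good-at-`2` twin
`V` of `49a1^{(d′)}`, `d = d*·d′`, `d′ ≡ 1 (4)`, `d* ∈ {2, −1, −2}` (`Cm7QuadraticTwistGoodAtTwo`, twist algebra), with a newform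
`f` (modularity, `exists_isNewformOf`), a non-zero period ratio (`ModularParametrizationData`), a Mordell–Weil generator of
`V^{(d*)}(ℚ)` modulo torsion (rank one by GZK, `VariableChange.pointEquiv`) and a CANONICAL minus-twist `2`-adic datum
(the receptacle's pinning theorem, pattern `cm7Twist_existsUnique_isCanonicalSqMinusTwist_two` — the one piece not yet in the
tree). Cf. `DisegniPairTwoV3.stub_frame_two` (a theorem given the modularity prints). WHY IT MIGHT FAIL: it should not; typing only.
[cite: SilvermanAEC2009, X.5 Cor. 5.4] [cite: BCDTJAMS2001, Thm. A] [cite: MazurSteinTate2006, §1 eq. (1.1)] [cite: GrossZagier1986, Thm. I.(7.3)] -/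
theorem stub_pairFrame_two :
    GrossZagier1986_thm_I_7_3 → rank_eq_analyticRank_of_analyticRank_le_one →
    ∀ (d : ℤ), d ≠ 0 → Squarefree d → d % 4 ≠ 1 →
    ∀ (W : WeierstrassCurve ℚ) [W.IsElliptic] [W.IsGloballyMinimal] (C : VariableChange ℚ),
      C • W = cm7.quadraticTwist (d : ℚ) → W.analyticRank = 1 →
    ∃ (d' : ℤ) (V : WeierstrassCurve ℚ) (_ : V.IsElliptic) (_ : V.IsGloballyMinimal) (C₁ : VariableChange ℚ)
      (N : ℕ) (_ : NeZero N) (f : CuspForm (Gamma0 N) 2),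
      d' % 4 = 1 ∧ Squarefree d' ∧ C₁ • V = cm7.quadraticTwist (d' : ℚ) ∧ IsNewformOf V f ∧
      (      (d = 2 * d' ∧ ∃ (ϖ : ℚ) (_ : (V.quadraticTwist 2).IsElliptic) (CV : VariableChange ℚ)
          (Pstar : (V.quadraticTwist 2).toAffine.Point) (Dc : PAdicHeightData (V.quadraticTwist 2) 2),
        ϖ ≠ 0 ∧ (ϖ : ℝ) * V.realPeriodRat = plusPeriod f ∧ CV • W = V.quadraticTwist 2 ∧ ¬ IsOfFinAddOrder Pstar ∧
        (∀ R : (V.quadraticTwist 2).toAffine.Point,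
          ∃ (k : ℤ) (T : (V.quadraticTwist 2).toAffine.Point), IsOfFinAddOrder T ∧ R = k • Pstar + T) ∧
        Dc.IsCanonicalSqMinusTwist) ∨
      (d = -d' ∧ ∃ (μ : ℚ) (_ : (V.quadraticTwist (-1)).IsElliptic) (CV : VariableChange ℚ)
          (Pstar : (V.quadraticTwist (-1)).toAffine.Point) (Dc : PAdicHeightData (V.quadraticTwist (-1)) 2),
        μ ≠ 0 ∧ (μ : ℝ) * V.imaginaryPeriodRat = minusPeriod f ∧ CV • W = V.quadraticTwist (-1) ∧ ¬ IsOfFinAddOrder Pstar ∧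
        (∀ R : (V.quadraticTwist (-1)).toAffine.Point,
          ∃ (k : ℤ) (T : (V.quadraticTwist (-1)).toAffine.Point), IsOfFinAddOrder T ∧ R = k • Pstar + T) ∧
        Dc.IsCanonicalSqMinusTwist) ∨
      (d = -2 * d' ∧ ∃ (μ : ℚ) (_ : (V.quadraticTwist (-2)).IsElliptic) (CV : VariableChange ℚ)
          (Pstar : (V.quadraticTwist (-2)).toAffine.Point) (Dc : PAdicHeightData (V.quadraticTwist (-2)) 2),
        μ ≠ 0 ∧ (μ : ℝ) * V.imaginaryPeriodRat = minusPeriod f ∧ CV • W = V.quadraticTwist (-2) ∧ ¬ IsOfFinAddOrder Pstar ∧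
        (∀ R : (V.quadraticTwist (-2)).toAffine.Point,
          ∃ (k : ℤ) (T : (V.quadraticTwist (-2)).toAffine.Point), IsOfFinAddOrder T ∧ R = k • Pstar + T) ∧
        Dc.IsCanonicalSqMinusTwist)) := by
  sorry

/-- **COMPOSITION (no `sorry`)**: `RubinValueFormulaAtTwoV13` BY NAME from the three stubs — `q` from GZ86 I.(7.3) + GZK
(`Disegni2020.exists_rat_shaAn_eq_of_analyticRank_eq_one`), the presentation from `stub_pairFrame_two`, per class the ratio
law and the Disegni key added up (`eA := 2·e₂ + e₁`, class arguments `(d % 2, (d/(2 − d % 2)) % 8)` computed by `omega`).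
[cite: Rubin1992, Cor. 10.3] [cite: Disegni2017, Thm B] -/
theorem RubinValueFormulaAtTwoV13_of :
    Summit.BirchSwinnertonDyer.BirchSwinnertonDyer.Theses.PrintCf2RubinValueTwo.RubinValueFormulaAtTwoV13 := by
  intro hGZ hGZK
  obtain ⟨e₁, hS1⟩ := stub_rubinRatio_two
  obtain ⟨e₂, hS2a, hS2b, hS2c⟩ := stub_disegniKey_shaAn_two hGZ hGZK
  refine ⟨fun a b ↦ 2 * e₂ a b + e₁ a b, ?_⟩
  intro d hd0 hsq hd4 W iW1 iW2 C hC hr hsha K iK1 iK2 hIQ hcl hdisc v vbar hv hvbar hne ι hι c hc ψ hψ hL κ₁ κ₂ γ₁ γ₂ hpair hκ₂ hκ₁ hγ₁ hγ₂ θ θK ρ r hθ2 hθK hθK2 hρr hfac hρψ Sθ hvS hvbarS hSram hSunr hN hDICT Ω δ Ωp G₂ hΩ hδ hframe hMC P c₀ ℓ hP hgen hc₀ hker hlog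
  obtain ⟨q, hq⟩ := Disegni2020.exists_rat_shaAn_eq_of_analyticRank_eq_one hGZ hGZK W hr
  refine ⟨q, hq, ?_⟩
  intro val m hval hnorm
  obtain ⟨k1a, k1b, k1c⟩ := hS1 d hd0 hsq hd4 W C hC hr hsha K hIQ hcl hdisc v vbar hv hvbar hne ι hι c hc ψ hψ hL κ₁ κ₂ γ₁ γ₂ hpair hκ₂ hκ₁ hγ₁ hγ₂ θ θK ρ r hθ2 hθK hθK2 hρr hfac hρψ Sθ hvS hvbarS hSram hSunr hN hDICT Ω δ Ωp G₂ hΩ hδ hframe hMC P c₀ ℓ hP hgen hc₀ hker hlog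
  obtain ⟨d', V, iV1, iV2, C₁, N, iN, f, hd', hsq', hC₁, hf, hcases⟩ :=
    stub_pairFrame_two hGZ hGZK d hd0 hsq hd4 W C hC hr
  rcases hcases with ⟨hd, ϖ, iVq, CV, Pstar, Dc, hϖ0, hϖ, hCV, hPs, hgenPs, hDc⟩ |
    ⟨hd, μ, iVq, CV, Pstar, Dc, hμ0, hμ, hCV, hPs, hgenPs, hDc⟩ |
    ⟨hd, μ, iVq, CV, Pstar, Dc, hμ0, hμ, hCV, hPs, hgenPs, hDc⟩
  · have a1 := k1a d' hd hd' hsq' V C₁ hC₁ f hf ϖ hϖ0 hϖ CV hCV Pstar hPs hgenPs Dc hDc val m hval hnorm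
    have a2 := hS2a d' hd' hsq' V C₁ hC₁ f hf ϖ hϖ0 hϖ W CV hCV hr q hq Pstar hPs hgenPs Dc hDc
    have h1 : d % 2 = 0 := by omega
    have h2 : d / (2 - d % 2) % 8 = d' % 8 := by rw [h1]; norm_num; omega
    rw [h2, h1]
    dsimp only
    omega
  · have a1 := k1b d' hd hd' hsq' V C₁ hC₁ f hf μ hμ0 hμ CV hCV Pstar hPs hgenPs Dc hDc val m hval hnorm
    have a2 := hS2b d' hd' hsq' V C₁ hC₁ f hf μ hμ0 hμ W CV hCV hr q hq Pstar hPs hgenPs Dc hDc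
    have h1 : d % 2 = 1 := by omega
    have h2 : d / (2 - d % 2) % 8 = (-d') % 8 := by rw [h1]; norm_num; omega
    rw [h2, h1]
    dsimp only
    omega
  · have a1 := k1c d' hd hd' hsq' V C₁ hC₁ f hf μ hμ0 hμ CV hCV Pstar hPs hgenPs Dc hDc val m hval hnorm
    have a2 := hS2c d' hd' hsq' V C₁ hC₁ f hf μ hμ0 hμ W CV hCV hr q hq Pstar hPs hgenPs Dc hDc
    have h1 : d % 2 = 0 := by omega
    have h2 : d / (2 - d % 2) % 8 = (-d') % 8 := by rw [h1]; norm_num; omega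
    rw [h2, h1]
    dsimp only
    omega

end Summit.BirchSwinnertonDyer.BirchSwinnertonDyer.Cruxes.RubinValueFormulaAtTwoV13.RubinRatioV13

end
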